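import Literature.NumberTheory.DiophantineGeometry.GenEllImageModLContainsSL2
import Literature.NumberTheory.GaloisRepresentations.AbsGaloisGroup
import HarnessLib

/-!
# The Galois image on `E[l]` keeps `SL₂(𝔽_l)` UP a Galois extension of degree prime to `l`

S. Mochizuki, *Inter-universal Teichmüller theory IV*, RIMS manuscript (Apr. 2020; = PRIMS **57**
(2021)), proof of Cor. 2.2 (ii), (P6) p. 46 ("the image of the outer homomorphism `Gal(Q̄/F) → GL₂(𝔽_l)`
determined by the `l`-torsion points of `E_F` contains the subgroup `SL₂(𝔽_l)`") together with Thm. 1.10,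
p. 22 (the field `F` of the initial Θ-data is an extension of `F_tpd` with
`Gal(F/F_tpd) ↪ GL₂(𝔽₃) × GL₂(𝔽₅) × ℤ/2ℤ`, so `[F : F_tpd]` is prime to `l ≥ 7`): condition (P6) has to be
moved between the various fields of definition of the curve that occur (the theta-field
`F_tpd(√−1, E[3·5])` of Cor. 2.2, the field `F_mod(√−1, E_{F_mod}[2·3·5])` of Thm. 1.10), all of which are
Galois over `F_tpd` of degree prime to `l`.  The classical fact that makes this harmless is PROVED here
(theorem-only file, no definitions, no named facts), for a presented elliptic curve `P = (K, E)`
(`GenEll.EllPoint`) and its base change `P′ = ⟨K′, E ×_K K′⟩` to a finite GALOIS extension `K′/K`: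

* `EllPoint.imageModLContainsSL2_map_of_isGalois_of_not_dvd` — if `l` is a prime NOT dividing
  `[K′ : K]` and the image of `Gal(K̄/K)` on `E[l]` contains `SL₂(𝔽_l)` (`ImageModLContainsSL2 P l`), then
  so does the image of `Gal(K̄′/K′)` (`ImageModLContainsSL2 P′ l`).

Proof (Dickson/Serre-style, elementary): `Γ_{K′}` is a normal subgroup of `Gal(K̄′/K)` with quotient
`Gal(K′/K)` of order `m = [K′:K]` prime to `l`; every transvection `u` of `E[l] ≅ 𝔽_l²` (so `u^l = 1`)
is the action of some `g ∈ Gal(K̄′/K)` (hypothesis, transported along `K̄′ ≅_K K̄`), hence `g^m ∈ Γ_{K′}`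
acts as `u^m`, and `(g^m)^a` acts as `u^{ma} = u` for `ma ≡ 1 (mod l)`; since `SL₂(𝔽_l)` is generated by
transvections (Mathlib `Matrix.SL2.transvection_induction`), every determinant-one automorphism of `E[l]`
is the action of an element of `Γ_{K′}`.  The converse direction (DOWN a finite extension) is the tree's
`EllPoint.imageModLContainsSL2_of_baseChange` (`GenEllBaseChangeGalois.lean`).

## References

* S. Mochizuki, op. cit., Cor. 2.2 (ii) (P6) p. 46; Thm. 1.10 p. 22. [Mochizuki2012]
* J.-P. Serre, *Propriétés galoisiennes des points d'ordre fini des courbes elliptiques*, Invent. Math.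
  15 (1972), §2. [Serre1972PointsOrdreFini]
* J. H. Silverman, *The Arithmetic of Elliptic Curves*, III.§7. [SilvermanAEC2009]
-/

noncomputable section

open WeierstrassCurve Field

namespace Literature.NumberTheory.DiophantineGeometry.GenEll

namespace EllPoint

open Literature.NumberTheory.EllipticCurves Literature.NumberTheory.GaloisRepresentations

universe u

variable (P : EllPoint) (L' : Type) [Field L'] [NumberField L'] [Algebra P.F L']

/-- In `SL₂`, a transvection raised to the `n`-th power is the transvection with parameter `n·c`.
[cite: Serre1972PointsOrdreFini, §2] -/
private theorem transvection_pow {F : Type*} [CommRing F] {i j : Fin 2} (hij : i ≠ j) (c : F) (n : ℕ) :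
    Matrix.SpecialLinearGroup.transvection hij c ^ n =
      Matrix.SpecialLinearGroup.transvection hij ((n : F) * c) := by
  induction n with
  | zero => simp
  | succ n ih =>
    rw [pow_succ, ih, Nat.cast_succ, add_mul, one_mul, Matrix.SpecialLinearGroup.transvection_add]

/-- **`SL₂ ⊆` Galois image is preserved UP a Galois extension of degree prime to `l`.** For a presented
elliptic curve `P = (K, E)`, a finite Galois extension `K′/K` with `l ∤ [K′ : K]` (`l` prime), and the
base-changed presentation `P′ = (K′, E ⊗_K K′)`: if every determinant-one `𝔽_l`-linear endomorphism of
`E[l](K̄)` is the action of an element of `Gal(K̄/K)`, then every determinant-one `𝔽_l`-linear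
endomorphism of `E[l](K̄′)` is the action of an element of `Gal(K̄′/K′)` — the form in which (P6) for
`E_F` over the field of the Θ-data (`[F : F_tpd]` prime to `l ≥ 7`, Thm. 1.10 p. 22) follows from (P6)
over a smaller field. [cite: Mochizuki2012, IUTchIV Cor. 2.2 (ii) (P6) p.46] -/
theorem imageModLContainsSL2_map_of_isGalois_of_not_dvd (l : ℕ) [Fact l.Prime] [IsGalois P.F L']
    (hcop : ¬ l ∣ Module.finrank P.F L') (h : P.ImageModLContainsSL2 l) :
    ({ F := L', W := P.W.map (algebraMap P.F L') } : EllPoint).ImageModLContainsSL2 l := by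
  classical
  have hl : l.Prime := Fact.out
  set P' : EllPoint := { F := L', W := P.W.map (algebraMap P.F L') } with hP'
  haveI : Module.Finite P.F L' := Module.Finite.of_restrictScalars_finite ℚ P.F L'
  haveI : Algebra.IsAlgebraic P.F L' := Algebra.IsAlgebraic.of_finite P.F L'
  -- notation for the two algebraic closures
  set Kb := AlgebraicClosure P.F with hKb
  set Kb' := AlgebraicClosure L' with hKb'
  set ι : Kb' ≃ₐ[P.F] Kb := IsAlgClosure.equivOfAlgebraic P.F L' Kb' Kb with hι
  /- ### 1. Transport of geometric points along `ι` (as in `GenEllBaseChangeGalois`) -/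
  set Φ : geomPoints (P.W.map (algebraMap P.F L')) →+ geomPoints P.W :=
    Affine.Point.map (W' := P.W) (ι : Kb' →ₐ[P.F] Kb) with hΦ
  set Ψ : geomPoints P.W →+ geomPoints (P.W.map (algebraMap P.F L')) :=
    Affine.Point.map (W' := P.W) (ι.symm : Kb →ₐ[P.F] Kb') with hΨ
  have hΨΦ : ∀ Q, Ψ (Φ Q) = Q := by
    intro Q
    have hcomp : (ι.symm : Kb →ₐ[P.F] Kb').comp (ι : Kb' →ₐ[P.F] Kb) = AlgHom.id P.F _ := by
      ext x; exact ι.symm_apply_apply x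
    show Affine.Point.map (W' := P.W) (ι.symm : Kb →ₐ[P.F] Kb')
      (Affine.Point.map (W' := P.W) (ι : Kb' →ₐ[P.F] Kb) Q) = Q
    rw [Affine.Point.map_map, hcomp]
    cases Q <;> rfl
  have hΦΨ : ∀ Q, Φ (Ψ Q) = Q := by
    intro Q
    have hcomp : (ι : Kb' →ₐ[P.F] Kb).comp (ι.symm : Kb →ₐ[P.F] Kb') = AlgHom.id P.F _ := by
      ext x; exact ι.apply_symm_apply x
    show Affine.Point.map (W' := P.W) (ι : Kb' →ₐ[P.F] Kb)
      (Affine.Point.map (W' := P.W) (ι.symm : Kb →ₐ[P.F] Kb') Q) = Q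
    rw [Affine.Point.map_map, hcomp]
    cases Q <;> rfl
  /- ### 2. The big group `Gal(K̄′/K)` acting on `E(K̄′)` -/
  set act : (Kb' ≃ₐ[P.F] Kb') → geomPoints (P.W.map (algebraMap P.F L')) →+
      geomPoints (P.W.map (algebraMap P.F L')) :=
    fun g => Affine.Point.map (W' := P.W) (g : Kb' →ₐ[P.F] Kb') with hact
  have act_one : ∀ Q, act 1 Q = Q := by
    intro Q; cases Q <;> rfl
  have act_mul : ∀ g g' Q, act (g * g') Q = act g (act g' Q) := by
    intro g g' Q
    have hcomp : (g : Kb' →ₐ[P.F] Kb').comp (g' : Kb' →ₐ[P.F] Kb') = ((g * g' : Kb' ≃ₐ[P.F] Kb') :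
        Kb' →ₐ[P.F] Kb') := by
      ext x; rfl
    show Affine.Point.map (W' := P.W) ((g * g' : Kb' ≃ₐ[P.F] Kb') : Kb' →ₐ[P.F] Kb') Q =
      Affine.Point.map (W' := P.W) (g : Kb' →ₐ[P.F] Kb')
        (Affine.Point.map (W' := P.W) (g' : Kb' →ₐ[P.F] Kb') Q)
    rw [Affine.Point.map_map, hcomp]
  -- the subgroup `Γ_{K'}` acts through `act`
  set rs : absoluteGaloisGroup L' → (Kb' ≃ₐ[P.F] Kb') := fun τ =>
    (absoluteGaloisGroup.toAlgEquiv L' τ).restrictScalars P.F with hrs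
  have act_rs : ∀ (τ : absoluteGaloisGroup L') (Q : geomPoints (P.W.map (algebraMap P.F L'))),
      τ • Q = act (rs τ) Q := by
    intro τ Q; cases Q <;> rfl
  have rs_mul : ∀ τ τ' : absoluteGaloisGroup L', rs (τ * τ') = rs τ * rs τ' := by
    intro τ τ'; apply AlgEquiv.ext; intro x; simp [hrs]
  -- equivariance of `Φ` for the conjugate action: `Φ (act (ι⁻¹ σ ι) Q) = σ • Φ Q`
  set lower : absoluteGaloisGroup P.F → (Kb' ≃ₐ[P.F] Kb') := fun σ =>
    ι.trans ((absoluteGaloisGroup.toAlgEquiv P.F σ).trans ι.symm) with hlower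
  have hequiv : ∀ (σ : absoluteGaloisGroup P.F) (Q : geomPoints (P.W.map (algebraMap P.F L'))),
      Φ (act (lower σ) Q) = σ • Φ Q := by
    intro σ Q
    set σ' : Kb →ₐ[P.F] Kb := ((absoluteGaloisGroup.toAlgEquiv P.F σ : Kb ≃ₐ[P.F] Kb) :
      Kb →ₐ[P.F] Kb) with hσ'
    have h2 : σ • Φ Q = Affine.Point.map (W' := P.W) σ' (Φ Q) := by
      cases (Φ Q) <;> rfl
    have hcomp : (ι : Kb' →ₐ[P.F] Kb).comp (lower σ : Kb' →ₐ[P.F] Kb') =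
        σ'.comp (ι : Kb' →ₐ[P.F] Kb) := by
      ext x
      simp [hlower, hσ', AlgEquiv.apply_symm_apply]
    rw [h2]
    show Affine.Point.map (W' := P.W) (ι : Kb' →ₐ[P.F] Kb)
        (Affine.Point.map (W' := P.W) (lower σ : Kb' →ₐ[P.F] Kb') Q) =
      Affine.Point.map (W' := P.W) σ' (Affine.Point.map (W' := P.W) (ι : Kb' →ₐ[P.F] Kb) Q)
    rw [Affine.Point.map_map, Affine.Point.map_map, hcomp]
  /- ### 3. Restriction to the `l`-torsion -/
  set V := P.W.geomTorsion (l : ℤ) with hV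
  set V' := (P.W.map (algebraMap P.F L')).geomTorsion (l : ℤ) with hV'
  have hΦmem : ∀ Q : V', Φ (Q : geomPoints (P.W.map (algebraMap P.F L'))) ∈ V := by
    intro Q
    show _ ∈ P.W.geomTorsion (l : ℤ)
    rw [AddSubgroup.torsionBy.nsmul_iff, ← map_nsmul, AddSubgroup.torsionBy.nsmul_iff.mp Q.2, map_zero]
  have hΨmem : ∀ Q : V, Ψ (Q : geomPoints P.W) ∈ V' := by
    intro Q
    show _ ∈ (P.W.map (algebraMap P.F L')).geomTorsion (l : ℤ)
    rw [AddSubgroup.torsionBy.nsmul_iff, ← map_nsmul, AddSubgroup.torsionBy.nsmul_iff.mp Q.2, map_zero]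
  have hact_mem : ∀ (g : Kb' ≃ₐ[P.F] Kb') (Q : V'),
      act g (Q : geomPoints (P.W.map (algebraMap P.F L'))) ∈ V' := by
    intro g Q
    show _ ∈ (P.W.map (algebraMap P.F L')).geomTorsion (l : ℤ)
    rw [AddSubgroup.torsionBy.nsmul_iff, ← map_nsmul, AddSubgroup.torsionBy.nsmul_iff.mp Q.2, map_zero]
  set ΦT : V' ≃+ V :=
    { toFun := fun Q => ⟨Φ Q, hΦmem Q⟩
      invFun := fun Q => ⟨Ψ Q, hΨmem Q⟩
      left_inv := fun Q => Subtype.ext (hΨΦ Q)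
      right_inv := fun Q => Subtype.ext (hΦΨ Q)
      map_add' := fun Q Q' => Subtype.ext (by simp) } with hΦT
  have hΦT_coe : ∀ Q, ((ΦT Q : V) : geomPoints P.W) = Φ Q := fun Q => rfl
  letI instL : Module (ZMod l) V := AddSubgroup.torsionBy.zmodModule
  letI instL' : Module (ZMod l) V' := AddSubgroup.torsionBy.zmodModule
  -- `act g` on the torsion, as a `ZMod l`-linear map
  set actT : (Kb' ≃ₐ[P.F] Kb') → V' →ₗ[ZMod l] V' := fun g =>
    (({ toFun := fun Q => ⟨act g Q, hact_mem g Q⟩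
        map_zero' := Subtype.ext (by simp)
        map_add' := fun Q Q' => Subtype.ext (by simp) } : V' →+ V')).toZModLinearMap l with hactT
  have actT_coe : ∀ g (Q : V'), ((actT g Q : V') : geomPoints (P.W.map (algebraMap P.F L'))) =
      act g Q := fun g Q => rfl
  have actT_one : ∀ Q : V', actT 1 Q = Q := fun Q => Subtype.ext (by rw [actT_coe, act_one])
  have actT_mul : ∀ g g' (Q : V'), actT (g * g') Q = actT g (actT g' Q) := fun g g' Q =>
    Subtype.ext (by rw [actT_coe, actT_coe, actT_coe, act_mul])
  have actT_rs : ∀ (τ : absoluteGaloisGroup L') (Q : V'), τ • Q = actT (rs τ) Q := by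
    intro τ Q
    apply Subtype.ext
    rw [AddSubgroup.torsionBy.coe_smul, actT_coe, act_rs]
  have hequivT : ∀ (σ : absoluteGaloisGroup P.F) (Q : V'), ΦT (actT (lower σ) Q) = σ • ΦT Q := by
    intro σ Q
    apply Subtype.ext
    rw [hΦT_coe, AddSubgroup.torsionBy.coe_smul, hΦT_coe, actT_coe, hequiv]
  /- ### 4. The hypothesis, transported: every `det = 1` endomorphism of `E[l](K̄′)` is the action of
  some element of `Gal(K̄′/K)` -/
  set Λ : V' ≃ₗ[ZMod l] V :=
    { ΦT.toAddMonoidHom.toZModLinearMap l with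
      invFun := ΦT.symm
      left_inv := fun x => ΦT.symm_apply_apply x
      right_inv := fun x => ΦT.apply_symm_apply x } with hΛ
  have hΛ_apply : ∀ x, Λ x = ΦT x := fun x => rfl
  have hΛ_symm : ∀ x, Λ.symm x = ΦT.symm x := fun x => rfl
  have hbig : ∀ f' : V' →ₗ[ZMod l] V', LinearMap.det f' = 1 →
      ∃ g : Kb' ≃ₐ[P.F] Kb', ∀ Q : V', actT g Q = f' Q := by
    intro f' hf'
    set f : V →ₗ[ZMod l] V := (Λ : V' →ₗ[ZMod l] V) ∘ₗ f' ∘ₗ (Λ.symm : V →ₗ[ZMod l] V') with hf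
    have hfdet : LinearMap.det f = 1 := by
      rw [hf, LinearMap.det_conj f' Λ]; exact hf'
    obtain ⟨σ, hσ⟩ := h f hfdet
    refine ⟨lower σ, fun Q => ?_⟩
    apply ΦT.injective
    have h1 : ΦT (actT (lower σ) Q) = σ • ΦT Q := hequivT σ Q
    rw [h1, hσ, hf]
    simp only [LinearMap.coe_comp, LinearEquiv.coe_coe, Function.comp_apply, hΛ_apply, hΛ_symm,
      ΦT.symm_apply_apply]
  /- ### 5. The normal subgroup `Γ_{K'}`: `g ^ [K':K] ∈ Γ_{K'}` -/
  set m : ℕ := Nat.card (L' ≃ₐ[P.F] L') with hm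
  have hm_eq : m = Module.finrank P.F L' := IsGalois.card_aut_eq_finrank P.F L'
  have hpow_mem : ∀ g : Kb' ≃ₐ[P.F] Kb', ∃ τ : absoluteGaloisGroup L', rs τ = g ^ m := by
    intro g
    have h1 : AlgEquiv.restrictNormalHom L' (g ^ m) = 1 := by
      rw [map_pow, hm, pow_card_eq_one']
    have hfix : ∀ x : L', (g ^ m) (algebraMap L' Kb' x) = algebraMap L' Kb' x := by
      intro x
      have h2 := AlgEquiv.restrictNormal_commutes (g ^ m) L' x
      have h3 : (g ^ m).restrictNormal L' = 1 := h1
      rw [h3, AlgEquiv.one_apply] at h2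
      exact h2.symm
    let τ' : Kb' ≃ₐ[L'] Kb' :=
      { (g ^ m : Kb' ≃ₐ[P.F] Kb').toRingEquiv with commutes' := hfix }
    refine ⟨(absoluteGaloisGroup.toAlgEquiv L').symm τ', ?_⟩
    apply AlgEquiv.ext
    intro x
    simp only [hrs, MulEquiv.apply_symm_apply, AlgEquiv.restrictScalars_apply]
    rfl
  /- ### 6. Realisation by `Γ_{K'}`: powers, products, and elements of order dividing `l` -/
  -- `τ` realises `f` :
  have real_mul : ∀ (τ τ' : absoluteGaloisGroup L') (f f' : V' →ₗ[ZMod l] V'),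
      (∀ Q, τ • Q = f Q) → (∀ Q, τ' • Q = f' Q) → ∀ Q, (τ * τ') • Q = (f * f') Q := by
    intro τ τ' f f' hτ hτ' Q
    rw [mul_smul, hτ', hτ, Module.End.mul_apply]
  have real_pow : ∀ (τ : absoluteGaloisGroup L') (f : V' →ₗ[ZMod l] V'),
      (∀ Q, τ • Q = f Q) → ∀ (n : ℕ) (Q : V'), (τ ^ n) • Q = (f ^ n) Q := by
    intro τ f hτ n
    induction n with
    | zero => intro Q; rw [pow_zero, pow_zero, one_smul, Module.End.one_apply]
    | succ n ih => intro Q; rw [pow_succ, pow_succ]; exact real_mul _ _ _ _ ih hτ Q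
  have actT_pow : ∀ (g : Kb' ≃ₐ[P.F] Kb') (f : V' →ₗ[ZMod l] V'),
      (∀ Q, actT g Q = f Q) → ∀ (n : ℕ) (Q : V'), actT (g ^ n) Q = (f ^ n) Q := by
    intro g f hg n
    induction n with
    | zero => intro Q; rw [pow_zero, pow_zero, actT_one, Module.End.one_apply]
    | succ n ih => intro Q; rw [pow_succ, pow_succ, actT_mul, hg, ih, Module.End.mul_apply]
  -- the key step: an endomorphism `f` with `f ^ l = 1` and `det f = 1` is realised by `Γ_{K'}`
  have hcopr : Nat.Coprime m l := by
    rw [hm_eq]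
    exact (Nat.Coprime.symm ((Nat.Prime.coprime_iff_not_dvd hl).mpr hcop))
  obtain ⟨a, -, ha⟩ := Nat.exists_mul_mod_eq_one_of_coprime hcopr hl.one_lt
  have real_of_pow_eq_one : ∀ f : V' →ₗ[ZMod l] V', LinearMap.det f = 1 → f ^ l = 1 →
      ∃ τ : absoluteGaloisGroup L', ∀ Q, τ • Q = f Q := by
    intro f hf hfl
    obtain ⟨g, hg⟩ := hbig f hf
    obtain ⟨τ, hτ⟩ := hpow_mem g
    have hτm : ∀ Q, τ • Q = (f ^ m) Q := by
      intro Q; rw [actT_rs, hτ]; exact actT_pow g f hg m Q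
    refine ⟨τ ^ a, fun Q => ?_⟩
    rw [real_pow τ (f ^ m) hτm a Q, ← pow_mul]
    have hma : m * a = l * (m * a / l) + 1 := by
      have := Nat.div_add_mod (m * a) l
      rw [ha] at this
      exact this.symm
    rw [hma, pow_add, pow_mul, hfl, one_pow, pow_one, one_mul]
  /- ### 7. `SL₂(𝔽_l)` is generated by transvections -/
  have hA : Module.finrank (ZMod l) V' = 2 := P'.finrank_geomTorsion_eq_two l
  haveI : Module.Finite (ZMod l) V' := Module.finite_of_finrank_eq_succ hA
  set b : Module.Basis (Fin 2) (ZMod l) V' := Module.finBasisOfFinrankEq (ZMod l) V' hA with hb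
  have toLin_pow : ∀ (M : Matrix (Fin 2) (Fin 2) (ZMod l)) (n : ℕ),
      Matrix.toLin b b (M ^ n) = (Matrix.toLin b b M) ^ n := by
    intro M n
    induction n with
    | zero => rw [pow_zero, pow_zero, Matrix.toLin_one]; rfl
    | succ n ih => rw [pow_succ, pow_succ, Matrix.toLin_mul b b b, ih, Module.End.mul_eq_comp]
  have hSL : ∀ x : Matrix.SpecialLinearGroup (Fin 2) (ZMod l), ∃ τ : absoluteGaloisGroup L',
      ∀ Q : V', τ • Q = Matrix.toLin b b (x : Matrix (Fin 2) (Fin 2) (ZMod l)) Q := by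
    intro x
    induction x using Matrix.SL2.transvection_induction with
    | htransvec i j hij c =>
      apply real_of_pow_eq_one
      · rw [LinearMap.det_toLin]
        exact (Matrix.SpecialLinearGroup.transvection hij c).prop
      · have hT : (Matrix.SpecialLinearGroup.transvection hij c :
            Matrix.SpecialLinearGroup (Fin 2) (ZMod l)) ^ l = 1 := by
          rw [transvection_pow, ZMod.natCast_self, zero_mul,
            Matrix.SpecialLinearGroup.transvection_coeff_zero]
        rw [← toLin_pow, ← Matrix.SpecialLinearGroup.coe_pow, hT, Matrix.SpecialLinearGroup.coe_one,
          Matrix.toLin_one]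
        rfl
    | hmul A B hA hB =>
      obtain ⟨τ, hτ⟩ := hA
      obtain ⟨τ', hτ'⟩ := hB
      refine ⟨τ * τ', fun Q => ?_⟩
      rw [Matrix.SpecialLinearGroup.coe_mul, Matrix.toLin_mul b b b, real_mul τ τ' _ _ hτ hτ' Q,
        Module.End.mul_eq_comp]
  /- ### 8. Conclusion -/
  intro f' hf'
  set M : Matrix (Fin 2) (Fin 2) (ZMod l) := LinearMap.toMatrix b b f' with hM
  have hMdet : M.det = 1 := by rw [hM, LinearMap.det_toMatrix]; exact hf'
  obtain ⟨τ, hτ⟩ := hSL ⟨M, hMdet⟩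
  refine ⟨τ, fun Q => ?_⟩
  rw [hτ]
  show Matrix.toLin b b M Q = f' Q
  rw [hM, Matrix.toLin_toMatrix]

end EllPoint

end Literature.NumberTheory.DiophantineGeometry.GenEll

end
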